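import Literature.AnabelianGeometry.EtaleTheta.Discharge.Sec5EtaDiesOfBiTheta
import Literature.AnabelianGeometry.EtaleTheta.Discharge.Sec5Prop55EtaTautological

/-!
# [EtTh] Prop. 5.5 / P55-L02 (`EtaTautological`) at ANY §5 datum admitting the bi-theta isomorphism of Lemma 5.9 (iv) (proof-only)

Mochizuki, *The étale theta function and its Frobenioid-theoretic manifestations*, Publ. RIMS **45** (2009),
Prop. 5.5 proof p.327 (PDF p.101) l.−3 – p.328 l.1, Prop. 5.2 (iii) p.324 (PDF p.98), Lemma 5.9 (iv) p.332 (PDF p.106)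
[cite: MochizukiEtTh2009, Prop 5.5 proof p.327 (PDF p.101)].  abc-iut cell, layer L2, seat abc-iut-w4-d042 (gen 2);
PROOF-ONLY (0 definitions, 0 named facts).

abc-iut-w5-d123's `exists_eta_etaTautological_ofBiKummerData` (`Sec5Prop55EtaTautological.lean`, SUBDAG-EtTh-Thm56 row
P55-L02 at the carrier `ofBiKummerData`) produces the descended class `η` on `H_{B_N}` and proves `EtaTautological P η`
from {`hdies` (GAP G-w5d123-1), `hlift`/`hP` (row 2, GAP G-w5d123-2)}.  Here the SAME conclusion for an ARBITRARY §5
datum `𝔉` equipped with abc-iut-L2-t4's Lemma 5.9 (iv) data — a bi-theta isomorphism `i : E^Π_N ⥲ Π^tp_Y[μ_N]` lying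
over an identification `ι` with `ι(Π^tp_Ÿ̲) = Π^tp_Ÿ` — and the row-2 laws ONLY: the binder `hdies` is DISCHARGED by
`hdies_of_biTheta` (`Sec5EtaDiesOfBiTheta.lean`, p421641).
* `exists_eta_descent_of_biTheta` — the theta cocycle `η` of the isomorphism DESCENDS along `ρ` to `H_{B_N} = ρ(Π^tp_Ÿ̲)`
  through any coefficient map `e` (w5-d123's `ThetaEnvData.exists_descent_thetaCocycle` for `ρ ∘ ι⁻¹`, transported
  from `(ρ ∘ ι⁻¹)(Π^tp_Ÿ)` to `ρ(Π^tp_Ÿ̲)`);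
* `exists_eta_etaTautological_of_biTheta` — with `e := ψ⁻¹` and the row-2 laws (hlift, hP): there IS an `η_H` on `H_{B_N}`
  descending `η` with `Thm56Sub.EtaTautological 𝔉 P η_H` (P55-L02), by w5-d123's three-line argument
  (`RigidData.cocycle_lDeltaTheta` + `hP`).
HONEST FRAMING: inputs = Lemma 5.9 (iv)'s isomorphism data + MERGE-PLAN row 2; an ALTERNATIVE to the carrier route
(which discharges `hdies` from the `N`-th-root saturation, abc-iut-L6-t23 `Sec5Prop55EtaOfSaturation`), not a replacement;
[EtTh] refereed; no side taken on [IUTchIII] Cor. 3.12; typed ≠ proved.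
-/

noncomputable section

namespace Literature.AnabelianGeometry.EtaleTheta

open CategoryTheory
open FrobenioidCyclotomicRigidity

universe w v v' u u'

namespace ThetaFrobenioid

variable {C : Type u} [Category.{v} C] {D : Type u'} [Category.{v'} D] (𝔉 : ThetaFrobenioid.{w} C D)
  (h1 : 𝔉.SectionsFactor) (h3 : 𝔉.OuterActionLZ) (hsec : 𝔉.SgpCapSection) (hcs : 𝔉.SgpCupSection)
  (h8 : 𝔉.ConstantsEqNormalizer) (DK : Set (TopOut 𝔉.EPiN))

/-- `H_{B_N} = ρ(Π^tp_Ÿ̲)` is also `(ρ ∘ ι⁻¹)(Π^tp_Ÿ)` when `ι(Π^tp_Ÿ̲) = Π^tp_Ÿ` (elementwise).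
[cite: MochizukiEtTh2009, §5 p.331 (PDF p.105); Lem 5.9 (iv) p.332 (PDF p.106)] -/
theorem mem_map_rho_comp_symm_of_mem_HB {N : ℕ+} (T : ThetaEnvData.{v} N) (ι : 𝔉.PiX ≃ₜ* T.PiX)
    (hYdd : 𝔉.PiYdd.map ι.toMonoidHom = T.PiYdd) {a : Aut (𝔉.base.obj 𝔉.BN)} (ha : a ∈ 𝔉.HB) :
    a ∈ T.PiYdd.map (𝔉.ρ.comp ι.symm.toMulEquiv.toMonoidHom) := by
  obtain ⟨y, hy, rfl⟩ := ha
  refine ⟨ι y, ?_, ?_⟩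
  · rw [← hYdd]
    exact ⟨y, hy, rfl⟩
  · change 𝔉.ρ (ι.symm (ι y)) = 𝔉.ρ y
    rw [ι.symm_apply_apply]

/-- **Descent of the isomorphism's theta cocycle to `H_{B_N}`** (Prop. 5.2 (iii): the class `η` on `H_{B_N}`): given the
bi-theta isomorphism of Lemma 5.9 (iv) over `ι`, for every coefficient map `e : μ_N → B` there is `η_H : H_{B_N} → B`
with `η_H(ρ y) = e(η(ι y))` for all `y ∈ Π^tp_Ÿ̲` — w5-d123's `exists_descent_thetaCocycle`, its `hdies` supplied by
`hdies_of_biTheta`. [cite: MochizukiEtTh2009, Prop 5.2 (iii) p.324 (PDF p.98); Lem 5.9 (iv) p.332 (PDF p.106)] -/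
theorem exists_eta_descent_of_biTheta (T : ThetaEnvData.{v} 𝔉.N) (ι : 𝔉.PiX ≃ₜ* T.PiX)
    {η : T.PiYdd → T.mu} (hη : η ∈ T.thetaCocycles)
    (i : (𝔉.frdBiThetaEnv h1 h3 hsec hcs h8 DK).Iso (T.modelBi hη))
    (hi : ∀ x : 𝔉.EPiN, ((CycEnvelope.proj T.augY T.chi (i.e x) : T.PiY) : T.PiX) = ι (𝔉.toPiY x))
    (hYdd : 𝔉.PiYdd.map ι.toMonoidHom = T.PiYdd) {B : Type*} (e : T.mu → B) :
    ∃ ηH : 𝔉.HB → B, ∀ y : 𝔉.PiYdd, ηH (𝔉.rhoYdd y) = e (η ⟨ι (y : 𝔉.PiX), 𝔉.iota_mem_PiYdd T ι hYdd y⟩) := by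
  obtain ⟨η', hη'⟩ := T.exists_descent_thetaCocycle (𝔉.ρ.comp ι.symm.toMulEquiv.toMonoidHom) hη
    (fun k hk => 𝔉.hdies_of_biTheta h1 h3 hsec hcs h8 DK T ι hη i hi hYdd k hk) e
  refine ⟨fun a => η' ⟨(a : Aut (𝔉.base.obj 𝔉.BN)), 𝔉.mem_map_rho_comp_symm_of_mem_HB T ι hYdd a.2⟩, fun y => ?_⟩
  have hval : (𝔉.ρ.comp ι.symm.toMulEquiv.toMonoidHom)
      ((⟨ι (y : 𝔉.PiX), 𝔉.iota_mem_PiYdd T ι hYdd y⟩ : T.PiYdd) : T.PiX) =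
        ((𝔉.rhoYdd y : 𝔉.HB) : Aut (𝔉.base.obj 𝔉.BN)) := by
    change 𝔉.ρ (ι.symm (ι (y : 𝔉.PiX))) = 𝔉.ρ (y : 𝔉.PiX)
    rw [ι.symm_apply_apply]
  have harg : (⟨((𝔉.rhoYdd y : 𝔉.HB) : Aut (𝔉.base.obj 𝔉.BN)),
      𝔉.mem_map_rho_comp_symm_of_mem_HB T ι hYdd (𝔉.rhoYdd y).2⟩ :
        T.PiYdd.map (𝔉.ρ.comp ι.symm.toMulEquiv.toMonoidHom)) =
      ⟨(𝔉.ρ.comp ι.symm.toMulEquiv.toMonoidHom) ((⟨ι (y : 𝔉.PiX), 𝔉.iota_mem_PiYdd T ι hYdd y⟩ : T.PiYdd) : T.PiX),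
        Subgroup.mem_map_of_mem _ (⟨ι (y : 𝔉.PiX), 𝔉.iota_mem_PiYdd T ι hYdd y⟩ : T.PiYdd).2⟩ :=
    Subtype.ext hval.symm
  change η' _ = _
  rw [harg]
  exact hη' ⟨ι (y : 𝔉.PiX), 𝔉.iota_mem_PiYdd T ι hYdd y⟩

/-- **P55-L02 at ANY §5 datum with the bi-theta isomorphism, from the row-2 laws**: with `e := ψ⁻¹` and (hlift), (hP)
(GAP G-w5d123-2), there is `η_H : H_{B_N} → (l·Δ_Θ)_{B_N} ⊗ ℤ/Nℤ` descending the isomorphism's cocycle `η` and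
TAUTOLOGICAL on the part of `H_{B_N}` over `(l·Δ_Θ)_{B_N}` (`Thm56Sub.EtaTautological 𝔉 P η_H`): for `h = ρ k`,
`k ∈ Π^tp_Ÿ̲ ∩ ι⁻¹θ⁻¹(l·Δ_Θ)`: `η_H h = ψ⁻¹(η(ι k)) = ψ⁻¹(θ-mod(ι k)) = [proj h]` (w5-d123's argument).  No `hdies` binder.
[cite: MochizukiEtTh2009, Prop 5.5 proof p.327 (PDF p.101)] -/
theorem exists_eta_etaTautological_of_biTheta {l : ℕ} (R : RigidData.{v} 𝔉.N l) (ι : 𝔉.PiX ≃ₜ* R.PiX)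
    {η : R.PiYdd → R.mu} (hη : η ∈ R.thetaCocycles)
    (i : (𝔉.frdBiThetaEnv h1 h3 hsec hcs h8 DK).Iso (R.toThetaEnvData.modelBi hη))
    (hi : ∀ x : 𝔉.EPiN, ((CycEnvelope.proj R.augY R.chi (i.e x) : R.PiY) : R.PiX) = ι (𝔉.toPiY x))
    (hYdd : 𝔉.PiYdd.map ι.toMonoidHom = R.PiYdd) (P : ThetaSubquotientProj 𝔉) (ψ : 𝔉.lDeltaModN 𝔉.BN ≃* R.mu)
    (hlift : ∀ a ∈ 𝔉.HB, a ∈ P.pre (𝔉.base.obj 𝔉.BN) →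
      ∃ k : 𝔉.PiYdd, ι (k : 𝔉.PiX) ∈ R.lDeltaTheta ∧ 𝔉.ρ (k : 𝔉.PiX) = a)
    (hP : ∀ (k : 𝔉.PiYdd) (hk : ι (k : 𝔉.PiX) ∈ R.lDeltaTheta) (hm : 𝔉.ρ (k : 𝔉.PiX) ∈ P.pre (𝔉.base.obj 𝔉.BN)),
      (QuotientGroup.mk (P.proj _ ⟨𝔉.ρ (k : 𝔉.PiX), hm⟩) : 𝔉.lDeltaModN 𝔉.BN) =
        ψ.symm (R.thetaMod ⟨ι (k : 𝔉.PiX), hk⟩)) :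
    ∃ ηH : 𝔉.HB → 𝔉.lDeltaModN 𝔉.BN,
      (∀ y : 𝔉.PiYdd, ηH (𝔉.rhoYdd y) = ψ.symm (η ⟨ι (y : 𝔉.PiX), 𝔉.iota_mem_PiYdd R.toThetaEnvData ι hYdd y⟩)) ∧
      Thm56Sub.EtaTautological 𝔉 P ηH := by
  obtain ⟨ηH, hηH⟩ := 𝔉.exists_eta_descent_of_biTheta h1 h3 hsec hcs h8 DK R.toThetaEnvData ι hη i hi hYdd ψ.symm
  refine ⟨ηH, hηH, fun h hh => ?_⟩
  obtain ⟨k, hk, hρ⟩ := hlift _ h.2 hh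
  have hkh : 𝔉.rhoYdd k = h := Subtype.ext hρ
  subst hkh
  rw [hηH k, R.cocycle_lDeltaTheta η hη ⟨ι (k : 𝔉.PiX), 𝔉.iota_mem_PiYdd R.toThetaEnvData ι hYdd k⟩ hk]
  exact (hP k hk hh).symm

end ThetaFrobenioid

end Literature.AnabelianGeometry.EtaleTheta

end
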